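import Summits.CriticalPhenomena.Ising3DConformalLimit.Theses.SubPtolemyInterlacing
import Summits.CriticalPhenomena.Ising3DConformalLimit.Theorems.SubPtolemyInterlacingInterlacingAxisPair
import Literature.Probability.LatticeModels.CriticalUrsellFourSign
import Literature.Probability.LatticeModels.CriticalAxisRatioRegularity
import HarnessLib

/-!
# Line `Sketch` for the crux `SubPtolemyInterlacing.Interlacing` (stmt-CriticalPhenomena-15702) — stub `stub_ghsRegime`

The GHS regime of the interlacing inequality: given the GHS pivot floor
`S₄(p,x,y,z) ≤ G_px G_yz + G_py G_xz + G_pz G_xy − 2 G_px G_py G_pz` (hypothesis `hG`), pivoting at each of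
the four collinear axis points `x₁ = 0, x₂ = a e₁, x₃ = (a+b) e₁, x₄ = (a+b+c) e₁` gives
`S₄ ≤ P₁ + P₂ + P₃ − 2 M` with `M` the best of the four tree terms `π₁ … π₄`; multiplying by `P₂ ≥ 0`
(Griffiths) and adding the two-point criterion `(P₁+P₂+P₃) P₂ − P₁ P₃ ≤ 2 M P₂` yields `S₄ P₂ ≤ P₁ P₃`.
Pure algebra on `hG` through the axis dictionary `stub_axisPair`.

Helper file of the line `Sketch` (lead skeleton `Cruxes/Interlacing/Lines/Sketch.lean`): proves the registered stub
`stub_ghsRegime` verbatim (name + signature), after three permutation lemmas for the four-point correlator and the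
combined four-pivot bound `ghsRegime_two_mul_max_le`. No definitions, no named facts, no sorry.
-/

noncomputable section

namespace Summit.CriticalPhenomena.Ising3DConformalLimit.Cruxes.Interlacing.Sketch

open Filter MeasureTheory
open scoped symmDiff Topology
open Literature.Probability.LatticeModels Literature.Probability.Percolation

/-- Swapping the first two arguments of the critical four-point correlator (the spin monomial is a
commutative product). -/
theorem ghsRegime_corr4_perm01 (x q r w : Site 3) :
    criticalCorr 3 4 ![q, x, r, w] = criticalCorr 3 4 ![x, q, r, w] := by
  simp only [criticalCorr]
  congr 1
  funext s
  simp only [spinMonomial, Fin.prod_univ_four, Fin.isValue, Matrix.cons_val_zero, Matrix.cons_val_one,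
    Matrix.cons_val]
  ring

/-- Moving the third argument of the critical four-point correlator to the front. -/
theorem ghsRegime_corr4_perm2 (x q r w : Site 3) :
    criticalCorr 3 4 ![r, x, q, w] = criticalCorr 3 4 ![x, q, r, w] := by
  simp only [criticalCorr]
  congr 1
  funext s
  simp only [spinMonomial, Fin.prod_univ_four, Fin.isValue, Matrix.cons_val_zero, Matrix.cons_val_one,
    Matrix.cons_val]
  ring

/-- Moving the fourth argument of the critical four-point correlator to the front. -/
theorem ghsRegime_corr4_perm3 (x q r w : Site 3) :
    criticalCorr 3 4 ![w, x, q, r] = criticalCorr 3 4 ![x, q, r, w] := by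
  simp only [criticalCorr]
  congr 1
  funext s
  simp only [spinMonomial, Fin.prod_univ_four, Fin.isValue, Matrix.cons_val_zero, Matrix.cons_val_one,
    Matrix.cons_val]
  ring

/-- **The four pivots combined.** Under the GHS pivot floor `hG`, for any four sites `x q r w`,
`2 · max (max π₁ π₂) (max π₃ π₄) ≤ P₁ + P₂ + P₃ − S₄(x,q,r,w)` where `π₁ = G_xq G_xr G_xw`, `π₂ = G_xq G_qr G_qw`,
`π₃ = G_xr G_qr G_rw`, `π₄ = G_xw G_qw G_rw` are the four tree terms (pivot at `x`, `q`, `r`, `w`) and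
`P₁ = G_xq G_rw`, `P₂ = G_xr G_qw`, `P₃ = G_xw G_qr`, all pair correlators written with the earlier point first. -/
theorem ghsRegime_two_mul_max_le
    (hG : ∀ p x y z : Site 3,
      criticalCorr 3 4 ![p, x, y, z] ≤
        criticalCorr 3 2 ![p, x] * criticalCorr 3 2 ![y, z] + criticalCorr 3 2 ![p, y] * criticalCorr 3 2 ![x, z] +
          criticalCorr 3 2 ![p, z] * criticalCorr 3 2 ![x, y] -
        2 * (criticalCorr 3 2 ![p, x] * criticalCorr 3 2 ![p, y] * criticalCorr 3 2 ![p, z]))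
    (x q r w : Site 3) :
    2 * max
        (max (criticalCorr 3 2 ![x, q] * criticalCorr 3 2 ![x, r] * criticalCorr 3 2 ![x, w])
          (criticalCorr 3 2 ![x, q] * criticalCorr 3 2 ![q, r] * criticalCorr 3 2 ![q, w]))
        (max (criticalCorr 3 2 ![x, r] * criticalCorr 3 2 ![q, r] * criticalCorr 3 2 ![r, w])
          (criticalCorr 3 2 ![x, w] * criticalCorr 3 2 ![q, w] * criticalCorr 3 2 ![r, w])) ≤
      criticalCorr 3 2 ![x, q] * criticalCorr 3 2 ![r, w] + criticalCorr 3 2 ![x, r] * criticalCorr 3 2 ![q, w] +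
          criticalCorr 3 2 ![x, w] * criticalCorr 3 2 ![q, r] -
        criticalCorr 3 4 ![x, q, r, w] := by
  -- pivot at `x`
  have h1 := hG x q r w
  -- pivot at `q`
  have h2 := hG q x r w
  rw [ghsRegime_corr4_perm01, criticalCorr_two_pair_comm q x] at h2
  -- pivot at `r`
  have h3 := hG r x q w
  rw [ghsRegime_corr4_perm2, criticalCorr_two_pair_comm r x, criticalCorr_two_pair_comm r q] at h3
  -- pivot at `w`
  have h4 := hG w x q r
  rw [ghsRegime_corr4_perm3, criticalCorr_two_pair_comm w x, criticalCorr_two_pair_comm w q,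
    criticalCorr_two_pair_comm w r] at h4
  have hmax : max
        (max (criticalCorr 3 2 ![x, q] * criticalCorr 3 2 ![x, r] * criticalCorr 3 2 ![x, w])
          (criticalCorr 3 2 ![x, q] * criticalCorr 3 2 ![q, r] * criticalCorr 3 2 ![q, w]))
        (max (criticalCorr 3 2 ![x, r] * criticalCorr 3 2 ![q, r] * criticalCorr 3 2 ![r, w])
          (criticalCorr 3 2 ![x, w] * criticalCorr 3 2 ![q, w] * criticalCorr 3 2 ![r, w])) ≤
      (criticalCorr 3 2 ![x, q] * criticalCorr 3 2 ![r, w] + criticalCorr 3 2 ![x, r] * criticalCorr 3 2 ![q, w] +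
            criticalCorr 3 2 ![x, w] * criticalCorr 3 2 ![q, r] -
          criticalCorr 3 4 ![x, q, r, w]) / 2 :=
    max_le (max_le (by linarith) (by linarith)) (max_le (by linarith) (by linarith))
  linarith

/-- **Stub `stub_ghsRegime`** of the line `Sketch` (crux stmt-CriticalPhenomena-15702): the GHS regime of the crux.
Given the pivot floor (stub `stub_ghsPivot`, as the hypothesis `hG`), at every gap triple `(a,b,c)` whose axial
two-point data `G(n) = ⟨σ₀σ_{n e₁}⟩_{β_c}` satisfy `(P₁+P₂+P₃)·P₂ − P₁·P₃ ≤ 2·M·P₂` with `P₁ = G(a)G(c)`,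
`P₂ = G(a+b)G(b+c)`, `P₃ = G(a+b+c)G(b)` and `M = max (max π₁ π₂) (max π₃ π₄)`, `π₁ = G(a)G(a+b)G(a+b+c)`,
`π₂ = G(a)G(b)G(b+c)`, `π₃ = G(a+b)G(b)G(c)`, `π₄ = G(a+b+c)G(b+c)G(c)`, the `(a,b,c)` instance of `Interlacing`
holds: `S₄ ≤ P₁+P₂+P₃ − 2M` (the four pivots, `ghsRegime_two_mul_max_le`), times `P₂ ≥ 0` (Griffiths), plus the
criterion. Pure algebra on `hG` through the dictionary `stub_axisPair`. -/
theorem stub_ghsRegime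
    (hG : ∀ p x y z : Site 3,
      criticalCorr 3 4 ![p, x, y, z] ≤
        criticalCorr 3 2 ![p, x] * criticalCorr 3 2 ![y, z] + criticalCorr 3 2 ![p, y] * criticalCorr 3 2 ![x, z] +
          criticalCorr 3 2 ![p, z] * criticalCorr 3 2 ![x, y] -
        2 * (criticalCorr 3 2 ![p, x] * criticalCorr 3 2 ![p, y] * criticalCorr 3 2 ![p, z])) :
    ∀ a b c : ℕ,
    (criticalTwoPoint 3 (Pi.single 0 ((a : ℕ) : ℤ)) * criticalTwoPoint 3 (Pi.single 0 ((c : ℕ) : ℤ)) +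
          criticalTwoPoint 3 (Pi.single 0 ((a + b : ℕ) : ℤ)) * criticalTwoPoint 3 (Pi.single 0 ((b + c : ℕ) : ℤ)) +
          criticalTwoPoint 3 (Pi.single 0 ((a + b + c : ℕ) : ℤ)) * criticalTwoPoint 3 (Pi.single 0 ((b : ℕ) : ℤ))) *
        (criticalTwoPoint 3 (Pi.single 0 ((a + b : ℕ) : ℤ)) * criticalTwoPoint 3 (Pi.single 0 ((b + c : ℕ) : ℤ))) -
      criticalTwoPoint 3 (Pi.single 0 ((a : ℕ) : ℤ)) * criticalTwoPoint 3 (Pi.single 0 ((c : ℕ) : ℤ)) *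
        (criticalTwoPoint 3 (Pi.single 0 ((a + b + c : ℕ) : ℤ)) * criticalTwoPoint 3 (Pi.single 0 ((b : ℕ) : ℤ))) ≤
      2 * max
          (max (criticalTwoPoint 3 (Pi.single 0 ((a : ℕ) : ℤ)) * criticalTwoPoint 3 (Pi.single 0 ((a + b : ℕ) : ℤ)) *
              criticalTwoPoint 3 (Pi.single 0 ((a + b + c : ℕ) : ℤ)))
            (criticalTwoPoint 3 (Pi.single 0 ((a : ℕ) : ℤ)) * criticalTwoPoint 3 (Pi.single 0 ((b : ℕ) : ℤ)) *
              criticalTwoPoint 3 (Pi.single 0 ((b + c : ℕ) : ℤ))))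
          (max (criticalTwoPoint 3 (Pi.single 0 ((a + b : ℕ) : ℤ)) * criticalTwoPoint 3 (Pi.single 0 ((b : ℕ) : ℤ)) *
              criticalTwoPoint 3 (Pi.single 0 ((c : ℕ) : ℤ)))
            (criticalTwoPoint 3 (Pi.single 0 ((a + b + c : ℕ) : ℤ)) * criticalTwoPoint 3 (Pi.single 0 ((b + c : ℕ) : ℤ)) *
              criticalTwoPoint 3 (Pi.single 0 ((c : ℕ) : ℤ)))) *
        (criticalTwoPoint 3 (Pi.single 0 ((a + b : ℕ) : ℤ)) * criticalTwoPoint 3 (Pi.single 0 ((b + c : ℕ) : ℤ))) →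
    criticalCorr 3 4 ![((0 : ℕ) : ℤ) • (Pi.single 0 1 : Site 3), ((a : ℕ) : ℤ) • (Pi.single 0 1 : Site 3),
        ((a + b : ℕ) : ℤ) • (Pi.single 0 1 : Site 3), ((a + b + c : ℕ) : ℤ) • (Pi.single 0 1 : Site 3)] *
        (criticalCorr 3 2 ![((0 : ℕ) : ℤ) • (Pi.single 0 1 : Site 3), ((a + b : ℕ) : ℤ) • (Pi.single 0 1 : Site 3)] *
          criticalCorr 3 2 ![((a : ℕ) : ℤ) • (Pi.single 0 1 : Site 3), ((a + b + c : ℕ) : ℤ) • (Pi.single 0 1 : Site 3)]) ≤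
      criticalCorr 3 2 ![((0 : ℕ) : ℤ) • (Pi.single 0 1 : Site 3), ((a : ℕ) : ℤ) • (Pi.single 0 1 : Site 3)] *
          criticalCorr 3 2 ![((a + b : ℕ) : ℤ) • (Pi.single 0 1 : Site 3), ((a + b + c : ℕ) : ℤ) • (Pi.single 0 1 : Site 3)] *
        (criticalCorr 3 2 ![((0 : ℕ) : ℤ) • (Pi.single 0 1 : Site 3), ((a + b + c : ℕ) : ℤ) • (Pi.single 0 1 : Site 3)] *
          criticalCorr 3 2 ![((a : ℕ) : ℤ) • (Pi.single 0 1 : Site 3), ((a + b : ℕ) : ℤ) • (Pi.single 0 1 : Site 3)]) := by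
  intro a b c hreg
  -- the four pivots at the axis quadruple, in `criticalCorr` currency
  have hM := ghsRegime_two_mul_max_le hG (((0 : ℕ) : ℤ) • (Pi.single 0 1 : Site 3))
    (((a : ℕ) : ℤ) • (Pi.single 0 1 : Site 3)) (((a + b : ℕ) : ℤ) • (Pi.single 0 1 : Site 3))
    (((a + b + c : ℕ) : ℤ) • (Pi.single 0 1 : Site 3))
  -- the six infinite-volume pair correlators through the dictionary
  have h0a := stub_axisPair 0 a (Nat.zero_le _)
  have h0ab := stub_axisPair 0 (a + b) (Nat.zero_le _)
  have h0abc := stub_axisPair 0 (a + b + c) (Nat.zero_le _)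
  have haabc := stub_axisPair a (a + b + c) (by omega)
  have habab := stub_axisPair (a + b) (a + b + c) (by omega)
  have haab := stub_axisPair a (a + b) (by omega)
  rw [Nat.sub_zero] at h0a h0ab h0abc
  rw [show a + b + c - a = b + c by omega] at haabc
  rw [show a + b + c - (a + b) = c by omega] at habab
  rw [show a + b - a = b by omega] at haab
  rw [h0a, h0ab, h0abc, haabc, habab, haab] at hM
  rw [h0a, h0ab, h0abc, haabc, habab, haab]
  -- Griffiths: `P₂ ≥ 0`
  have hP2 : 0 ≤ criticalTwoPoint 3 (Pi.single 0 ((a + b : ℕ) : ℤ)) * criticalTwoPoint 3 (Pi.single 0 ((b + c : ℕ) : ℤ)) :=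
    mul_nonneg (criticalTwoPoint_nonneg' _) (criticalTwoPoint_nonneg' _)
  -- `2 M P₂ ≤ (P₁ + P₂ + P₃ - S₄) P₂`, then the criterion
  have hmul := mul_le_mul_of_nonneg_right hM hP2
  -- the eight real numbers, made opaque
  set S : ℝ := criticalCorr 3 4 ![((0 : ℕ) : ℤ) • (Pi.single 0 1 : Site 3), ((a : ℕ) : ℤ) • (Pi.single 0 1 : Site 3),
    ((a + b : ℕ) : ℤ) • (Pi.single 0 1 : Site 3), ((a + b + c : ℕ) : ℤ) • (Pi.single 0 1 : Site 3)]
  set Ga : ℝ := criticalTwoPoint 3 (Pi.single 0 ((a : ℕ) : ℤ))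
  set Gb : ℝ := criticalTwoPoint 3 (Pi.single 0 ((b : ℕ) : ℤ))
  set Gc : ℝ := criticalTwoPoint 3 (Pi.single 0 ((c : ℕ) : ℤ))
  set Gab : ℝ := criticalTwoPoint 3 (Pi.single 0 ((a + b : ℕ) : ℤ))
  set Gbc : ℝ := criticalTwoPoint 3 (Pi.single 0 ((b + c : ℕ) : ℤ))
  set Gabc : ℝ := criticalTwoPoint 3 (Pi.single 0 ((a + b + c : ℕ) : ℤ))
  set M : ℝ := max (max (Ga * Gab * Gabc) (Ga * Gb * Gbc)) (max (Gab * Gb * Gc) (Gabc * Gbc * Gc))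
  linarith [hmul, hreg]

end Summit.CriticalPhenomena.Ising3DConformalLimit.Cruxes.Interlacing.Sketch

end
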